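import Literature.IUT.HodgeTheaters.PiAvatarGlobalCuspLabels
import Literature.IUT.HodgeTheaters.PiAvatarGlobalLabelAction
import Literature.IUT.HodgeTheaters.PiAvatarCuspActionEquivariance
import Literature.IUT.HodgeTheaters.PiAvatarToFlStarInvolution
import HarnessLib

/-!
# Kit law `gLab_range` (→ half) at the genuine `𝒟^{⊚±}`: every `𝔽_l^{⋊±}`-automorphism of the label torsor `LabCusp^±(𝒟^{⊚±})`
# is `gLabMap α` for some `α ∈ Aut_±(𝒟^{⊚±})` — realised by `Gal(X̲_K/X_K)` (translations) and the `±` involution (sign)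
# (proof-only over the t4 P5-binding files)

S. Mochizuki, *Inter-universal Teichmüller theory I*, kurims manuscript (May 2020), Def 6.1 (v) p. 158 («we obtain a natural
outer isomorphism `Aut_K(X̲_K)/Aut_csp ≅ 𝔽_l^{⋊±}`»; `Aut_± ⊇ Aut_K(X̲_K)`) ([IUTchI] Def 6.1 (v) p.158) [claim: Mochizuki2012, status: disputed]
(D-0012 claim key, series status DISPUTED — kernel theorems over abc-iut-L5-t2's REAL `InitialThetaData`, abc-iut-L5-t1's `CuspGalois`,
under the binders `hS : D.CuspClassesNormaliserStable`, `[(D.PiXund.subgroupOf D.PiXK).Normal]`; nothing of the series is asserted,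
no side is taken on [IUTchIII] Cor. 3.12).

* `embK_mem_normalizer_PiXund` — `Π_{C_K}` normalises `Π_{X̲_K}` (every `embK c` induces an automorphism of `𝒟^{⊚±}`);
* `gChart₀Model_gLabAutModel_embK_of_mem_PiX` — for `g ∈ Π_X`, `gLabMap (aut (embK g))` reads as the TRANSLATION
  `z ↦ z + gChart₀ (g⁻¹·ε⁰)`, with `toFlStar = 1`; `exists_aut_translation` — every translation `z ↦ z + c` is so realised;
* `exists_aut_reflection` — the `±` involution realises `z ↦ −z` with `toFlStar = 1`;
* **`exists_aut_of_mem_autPM`** — every `σ ∈ Aut_±(LabCusp^±(𝒟^{⊚±}))` (`gLabTModel.autPM`) is `gLabAutModel α` with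
  `toFlStarGlobal α = 1` (the `→` half of the kit law `gLab_range`; the `←` half needs the affineness of `actF`, next file).
-/

noncomputable section

namespace Literature.IUT.HodgeTheaters

open CategoryTheory

universe u v w

section LabelRange

variable {F : Type u} {K : Type v} {Fbar : Type w} [Field F] [NumberField F] [Field K] [NumberField K]
  [Algebra F K] [Field Fbar] [Algebra F Fbar] [Algebra K Fbar]
  {E : WeierstrassCurve F} [E.IsElliptic] {l : ℕ} {Pb : BadPlacePredicates K}
  (D : InitialThetaData F K Fbar E l Pb) (CG : D.geom.pe.CuspGalois) (hS : D.CuspClassesNormaliserStable)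

namespace InitialThetaData

include CG in
/-- `Π_{C_K} = embK(Π_C)` normalises `Π_{X̲_K}` (`Π_X̲ ⊴ Π_C`). ([IUTchI] §1 p.37) [claim: Mochizuki2012, status: disputed] -/
theorem embK_mem_normalizer_PiXund (c : D.geom.pe.PiC) :
    D.geom.embK c ∈ Subgroup.normalizer ((D.PiXund : Subgroup D.PiC) : Set D.PiC) := by
  rw [Subgroup.mem_normalizer_iff]
  intro u
  constructor
  · exact fun hu => D.conj_embK_mem_PiXund CG c hu
  · intro hu
    have h := D.conj_embK_mem_PiXund CG c⁻¹ hu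
    simpa [map_inv, mul_assoc] using h

variable [Fact l.Prime]

/-- For `g ∈ Π_X`: `gLabMap (aut (embK g))` reads as the translation `z ↦ z + gChart₀ (g⁻¹·ε⁰)` in the chart based at `ε⁰`
(`gLabAutModel (aut (embK g)) = CG.act g⁻¹` and `Π_X` acts by translations). ([IUTchI] Def 6.1 (v) p.158) [claim: Mochizuki2012, status: disputed] -/
theorem gChart₀Model_gLabAutModel_embK_of_mem_PiX {g : D.geom.pe.PiC} (hg : g ∈ D.geom.pe.PiX) (x : D.geom.pe.Cusp) :
    D.gChart₀Model CG (D.gLabAutModel CG hS (OrbitCat.autOfNormalizer (D.geom.embK g) (D.embK_mem_normalizer_PiXund CG g)) x) =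
      D.gChart₀Model CG x + D.gChart₀Model CG (CG.act g⁻¹ D.geom.pe.ε0) := by
  rw [D.gLabAutModel_autOfNormalizer_embK CG hS]
  exact CG.labChart_act_of_mem_PiX _ (D.geom.pe.PiX.inv_mem hg) x

variable [(D.PiXund.subgroupOf D.PiXK).Normal]

/-- **Translations are realised**: for every `c : 𝔽_l` there is `α ∈ Aut(𝒟^{⊚±})` with `toFlStar α = 1` whose label action reads
`z ↦ z + c` (take `α = aut (embK g)` with `g = gen^{(-c)…}`, an element of `Gal(X̲_K/X_K)`). ([IUTchI] Def 6.1 (v) p.158) [claim: Mochizuki2012, status: disputed] -/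
theorem exists_aut_translation (c : ZMod l) :
    ∃ α : Aut (D.gModelObj), D.toFlStarGlobal α = 1 ∧
      ∀ x, D.gChart₀Model CG (D.gLabAutModel CG hS α x) = D.gChart₀Model CG x + c := by
  -- `g := (gen^{c.val})⁻¹ ∈ Π_X`, so that `g⁻¹·ε⁰ = σ^{c.val} ε⁰ = gChart₀⁻¹ c`
  set g : D.geom.pe.PiC := (CG.gen ^ c.val)⁻¹ with hgdef
  have hg : g ∈ D.geom.pe.PiX := D.geom.pe.PiX.inv_mem (D.geom.pe.PiX.pow_mem CG.gen_mem _)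
  refine ⟨OrbitCat.autOfNormalizer (D.geom.embK g) (D.embK_mem_normalizer_PiXund CG g), ?_, fun x => ?_⟩
  · apply D.toFlStarGlobal_eq_one_of_mem_PiXK
    rw [PiXK_eq_map]
    exact Subgroup.mem_map_of_mem _ hg
  · rw [D.gChart₀Model_gLabAutModel_embK_of_mem_PiX CG hS hg, hgdef, inv_inv, ← CG.sigma_pow, gChart₀Model,
      CG.labChart_sigma_pow_ε0]

/-- **The sign is realised**: there is `α ∈ Aut(𝒟^{⊚±})` (the `±` involution, induced by an element of `Π_C̲ ∖ Π_X`) with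
`toFlStar α = 1` whose label action reads `z ↦ −z`. ([IUTchI] Def 6.1 (v) p.158) [claim: Mochizuki2012, status: disputed] -/
theorem exists_aut_reflection :
    ∃ α : Aut (D.gModelObj), D.toFlStarGlobal α = 1 ∧
      ∀ x, D.gChart₀Model CG (D.gLabAutModel CG hS α x) = - D.gChart₀Model CG x := by
  obtain ⟨c', hc', hc'X⟩ := SetLike.not_le_iff_exists.mp D.pe_not_PiCbar_le_PiX
  have hcund : D.geom.embK c' ∈ D.PiCund := Subgroup.mem_map_of_mem _ hc'
  -- `c′ c′ ∈ Π_X̲` (index 2)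
  have h2 : c' * c' ∈ D.geom.pe.PiXbar := by
    have hidx : (D.geom.pe.PiXbar.subgroupOf D.geom.pe.PiCbar).index = 2 := D.geom.PiXbar_relIndex_PiCbar
    have key := (Subgroup.mul_mem_iff_of_index_two hidx (a := ⟨c', hc'⟩) (b := ⟨c', hc'⟩)).2 Iff.rfl
    rw [Subgroup.mem_subgroupOf] at key
    exact key
  refine ⟨OrbitCat.autOfNormalizer (D.geom.embK c') (D.embK_mem_normalizer_PiXund CG c'), ?_, fun x => ?_⟩
  · exact D.toFlStarGlobal_eq_one_of_mem_PiCund _ hcund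
  · rw [D.gLabAutModel_autOfNormalizer_embK_of_mul_self_mem CG hS c' _ h2]
    exact CG.labChart_act_of_not_mem_PiX _ hc' hc'X x

omit [(D.PiXund.subgroupOf D.PiXK).Normal] in
/-- Two permutations of the cusps reading the same in the chart are equal. ([IUTchI] Def 6.1 (v) p.158) [claim: Mochizuki2012, status: disputed] -/
theorem perm_eq_of_gChart₀Model_eq {σ τ : Equiv.Perm D.geom.pe.Cusp}
    (h : ∀ x, D.gChart₀Model CG (σ x) = D.gChart₀Model CG (τ x)) : σ = τ :=
  Equiv.ext fun x => (D.gChart₀Model CG).injective (h x)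

/-- **Kit law `gLab_range`, `→` half, at the genuine `𝒟^{⊚±}`**: every `σ ∈ Aut_±(LabCusp^±(𝒟^{⊚±}))` is the label action of
some `α ∈ Aut_±(𝒟^{⊚±})` (`toFlStar α = 1`) — `σ` reads `z ↦ εz + c`; compose a translation (from `Gal(X̲_K/X_K)`) with, if
`ε = −1`, the `±` involution. ([IUTchI] Def 6.1 (v) p.158) [claim: Mochizuki2012, status: disputed] -/
theorem exists_aut_of_mem_autPM {σ : Equiv.Perm D.geom.pe.Cusp} (hσ : σ ∈ (D.gLabTModel CG).autPM) :
    ∃ α : Aut (D.gModelObj), D.toFlStarGlobal α = 1 ∧ D.gLabAutModel CG hS α = σ := by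
  obtain ⟨g, hg⟩ := (FlPMTorsor.mem_autPM_iff _ σ).mp hσ _ (D.gChart₀Model_mem_charts CG)
  -- `σ` reads `z ↦ g.right • z + g.left`
  obtain ⟨αT, hT1, hT⟩ := D.exists_aut_translation CG hS (g.left.toAdd)
  rcases Int.units_eq_one_or g.right with hε | hε
  · -- positive: a translation
    refine ⟨αT, hT1, D.perm_eq_of_gChart₀Model_eq CG fun x => ?_⟩
    rw [hT, hg, FlPM.smul_def, hε, one_smul]
  · -- negative: translation ∘ reflection
    obtain ⟨αS, hS1, hSr⟩ := D.exists_aut_reflection CG hS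
    refine ⟨αT * αS, by rw [map_mul, hT1, hS1, mul_one], D.perm_eq_of_gChart₀Model_eq CG fun x => ?_⟩
    rw [map_mul, Equiv.Perm.mul_apply, hT, hSr, hg, FlPM.smul_def, hε, Units.neg_smul, one_smul, neg_add_eq_sub,
      sub_eq_neg_add]

end InitialThetaData

end LabelRange

end Literature.IUT.HodgeTheaters
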